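import Literature.NumberTheory.GaloisCohomology.PoitouTateRestrictedRamification
import Literature.NumberTheory.GaloisRepresentations.DiscreteCochains
import HarnessLib

/-!
# Inflation of modules over a discrete quotient of `Γ_K` to discrete `Γ_K`-modules:
# the functor `Q-Mod → Γ_K-Mod_disc` along `π : Γ_K →ₜ* Q`, exactness, unramifiedness outside `S`

Topic `NumberTheory/GaloisRepresentations`; namespace `Literature.NumberTheory.GaloisRepresentations`.
Definitions with bodies and theorems; no named fact, no `sorry`, no instance, no notation.
Lane «TATE-EPC-TC» of cell `bsd-eis` (road memo evidence #54 on stmt-BirchSwinnertonDyer-19032),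
brick (B9-pre): the reduction of Tate's global Euler–Poincaré characteristic formula (Milne,
*Arithmetic Duality Theorems*, I §5, proof of Thm. 5.1, p. 69: "let `L` … be a finite Galois
extension of `K` contained in `K_S` splitting `M` … `Ḡ = Gal(L/K)` … `φ` defines a homomorphism
`R_{𝔽_p}(Ḡ) → ℚ_{>0}`") regards a finite `Ḡ`-module as a `G_S`-module "through `G_S → Ḡ`"
(Serre, *Cohomologie galoisienne*, I §2.1: a discrete `G`-module on which an open normal subgroup
acts trivially "is" a module over the finite quotient; Harari Def. 15.36: `G_S`-modules as
`Γ_K`-modules on which `Gal(K̄/K_S)` acts trivially).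

Given a continuous homomorphism `π : Γ_K →ₜ* Q` to a DISCRETE group `Q` (e.g. `Q = G_{K,S} ⧸ U`
for `U` open normal, `π = (Γ_K ↠ G_{K,S}) ≫ (G_{K,S} ↠ G_{K,S}/U)`; or `Q = Gal(L/K)` for a finite
Galois `L ⊆ K̄`, `π = σ ↦ σ|_L`, `restrictNormalHomCont`):

* §1 `ContinuousRep.ofDiscrete ρ` — a representation of a discrete group on a discrete module is
  (jointly) continuous; **`DiscreteGaloisModule.inflate π ρY : DiscreteGaloisModule K Y`** — the
  discrete `Γ_K`-module `σ ↦ ρY (π σ)` attached to a `ℤ`-linear `Q`-representation `ρY` on the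
  (discrete) abelian group `Y`, `inflate_apply` (`rfl`); **`isUnramifiedOutside_inflate`**: if `π`
  kills `N_S` the inflated module is unramified outside `S` (a `G_S`-module).
  `Representation.ofIntModule inst ρ` re-bases a representation given for an ARBITRARY `ℤ`-module
  structure `inst` on `Y` (Mathlib's quotient / tensor instances) on the canonical one
  (`AddMonoidHom.toIntLinearMap`; the identity on maps, `ofIntModule_apply`) — the form in which the
  `(ψ, hψ)`-calculus of `RepresentationTheory/FiniteGroups/StableLatticeReductionInvariant*`
  (binders `[AddCommGroup X] [Module ℤ X]`) feeds `inflate`.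
* §2 functoriality **`DiscreteGaloisModule.inflateHom π f hf`**: a `Q`-equivariant additive map
  `f : Y →+ Y'` is a morphism of the inflated `TopRep`s (the identity on maps: `inflateHom_apply`),
  and **`isSES_inflateHom`**: a short exact sequence of `Q`-modules inflates to a short exact
  sequence of discrete `Γ_K`-modules (`IsSES`) — so every invariant of discrete `Γ_K`-modules that
  is additive on short exact sequences restricts to an additive invariant of `Q`-modules.
* §3 the two standard `π`: `toUnramifiedQuot_comp_eq_one_of_mem` (`Q = G_{K,S} ⧸ U`) and
  `restrictNormalHomCont`, `restrictNormalHomCont_eq_one_of_mem` (`Q = Gal(L/K)`).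

## References
* J. S. Milne, *Arithmetic Duality Theorems*, 2nd ed. (2006), I §5 (proof of Thm. 5.1, p. 69).
  [MilneADT2006]
* J.-P. Serre, *Cohomologie galoisienne* / *Galois Cohomology* (1997), I §2.1–2.2. [SerreGaloisCohomology1997]
* D. Harari, *Galois Cohomology and Class Field Theory* (2020), Def. 15.36, Remark 17.7 (b). [Harari2020]
-/

noncomputable section

open CategoryTheory Function NumberField Field IsDedekindDomain
open scoped NumberField

namespace Literature.NumberTheory.GaloisRepresentations

open _root_.TopRep _root_.ContRepresentation

universe u

/-! ### §1. Representations of discrete groups; inflation along `π : Γ_K →ₜ* Q` -/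

section OfDiscrete

variable {Q : Type*} [Group Q] [TopologicalSpace Q] [DiscreteTopology Q]
variable {A : Type*} [CommRing A] [TopologicalSpace A]
variable {Y : Type*} [AddCommGroup Y] [Module A Y] [TopologicalSpace Y] [DiscreteTopology Y]

/-- **A linear representation of a DISCRETE group on a DISCRETE module is a continuous
representation** (the action map `Q × Y → Y` has discrete source).
[cite: SerreGaloisCohomology1997, I §2.1] -/
def ContinuousRep.ofDiscrete (ρ : Representation A Q Y) : ContinuousRep Q A Y where
  toRepresentation := ρ
  continuous_smul := continuous_of_discreteTopology

/-- Unfolding lemma for `ContinuousRep.ofDiscrete`. [cite: SerreGaloisCohomology1997, I §2.1] -/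
@[simp] theorem ContinuousRep.ofDiscrete_apply (ρ : Representation A Q Y) (q : Q) :
    ContinuousRep.ofDiscrete ρ q = ρ q := rfl

end OfDiscrete

section OfIntModule

variable {Q : Type*} [Monoid Q] {Y : Type*} [AddCommGroup Y]

/-- **Re-basing a `ℤ`-linear representation on the canonical `ℤ`-module structure.**  A
representation `ρ` of `Q` on `Y` given for an arbitrary `ℤ`-module structure `inst` on the abelian
group `Y` (all such structures agree, `AddCommGroup.uniqueIntModule`, but not definitionally: e.g.
Mathlib's `Submodule.Quotient.module`, `TensorProduct` instances), viewed as a representation for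
the canonical structure `AddCommGroup.toIntModule Y` (each `ρ q` is the same additive map,
`AddMonoidHom.toIntLinearMap`). [cite: SerreGaloisCohomology1997, I §2.1] -/
def Representation.ofIntModule (inst : Module ℤ Y) (ρ : @Representation ℤ Q Y _ _ _ inst) :
    @Representation ℤ Q Y _ _ _ (AddCommGroup.toIntModule Y) where
  toFun q := (@LinearMap.toAddMonoidHom ℤ ℤ Y Y _ _ _ _ inst inst (RingHom.id ℤ) (ρ q)).toIntLinearMap
  map_one' := by
    refine DFunLike.ext _ _ fun y => ?_
    change ρ 1 y = y
    rw [map_one]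
    rfl
  map_mul' q q' := by
    refine DFunLike.ext _ _ fun y => ?_
    change ρ (q * q') y = ρ q (ρ q' y)
    rw [map_mul]
    rfl

/-- `ofIntModule inst ρ q y = ρ q y` (the identity on maps). [cite: SerreGaloisCohomology1997, I §2.1] -/
@[simp] theorem Representation.ofIntModule_apply (inst : Module ℤ Y) (ρ : @Representation ℤ Q Y _ _ _ inst)
    (q : Q) (y : Y) :
    @DFunLike.coe _ _ _ (@LinearMap.instFunLike ℤ ℤ Y Y _ _ _ _ (AddCommGroup.toIntModule Y)
      (AddCommGroup.toIntModule Y) (RingHom.id ℤ)) (Representation.ofIntModule inst ρ q) y = ρ q y :=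
  rfl

end OfIntModule

namespace DiscreteGaloisModule

section Inflate

variable {K : Type u} [Field K]
variable {Q : Type*} [Group Q] [TopologicalSpace Q] [DiscreteTopology Q]
variable (π : absoluteGaloisGroup K →ₜ* Q)
variable {Y : Type u} [AddCommGroup Y] [TopologicalSpace Y] [DiscreteTopology Y]

/-- **Inflation along `π : Γ_K →ₜ* Q`** of a `ℤ`-linear representation `ρY` of the discrete group
`Q` on the (discrete) abelian group `Y`: the discrete `Γ_K`-module `σ ↦ ρY (π σ)`.
[cite: MilneADT2006, I §5 (proof of Thm. 5.1, p. 69)] [cite: Harari2020, Def. 15.36] -/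
def inflate (ρY : Representation ℤ Q Y) : DiscreteGaloisModule K Y :=
  (ContinuousRep.ofDiscrete ρY).restrict π

/-- Unfolding lemma: `inflate π ρY σ y = ρY (π σ) y`. [cite: Harari2020, Def. 15.36] -/
@[simp] theorem inflate_apply (ρY : Representation ℤ Q Y) (σ : absoluteGaloisGroup K) (y : Y) :
    inflate π ρY σ y = ρY (π σ) y := rfl

/-- The inflated module is trivial on the kernel of `π`. [cite: SerreGaloisCohomology1997, I §2.1] -/
theorem inflate_apply_eq_self_of_map_eq_one (ρY : Representation ℤ Q Y)
    {σ : absoluteGaloisGroup K} (hσ : π σ = 1) (y : Y) : inflate π ρY σ y = y := by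
  rw [inflate_apply, hσ, map_one, Module.End.one_apply]

/-- `σ ∈ ker (inflate π ρY)` for `σ` in the kernel of `π`. [cite: SerreGaloisCohomology1997, I §2.1] -/
theorem mem_ker_inflate_of_map_eq_one (ρY : Representation ℤ Q Y)
    {σ : absoluteGaloisGroup K} (hσ : π σ = 1) : σ ∈ ContinuousRep.ker (inflate π ρY) :=
  (ContinuousRep.mem_ker _ σ).2 (LinearMap.ext fun y => inflate_apply_eq_self_of_map_eq_one π ρY hσ y)

/-- **The inflated module is unramified outside `S`** (a `G_S`-module) as soon as `π` kills the
ramification subgroup `N_S` — e.g. `π` factors through `Γ_K ↠ G_{K,S}`, or `π = (σ ↦ σ|_L)` with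
`L ⊆ K_S`. [cite: Harari2020, Def. 15.36 and Remark 17.7 (b)] -/
theorem isUnramifiedOutside_inflate [NumberField K] (ρY : Representation ℤ Q Y)
    (S : Set (HeightOneSpectrum (𝓞 K))) (hπ : ∀ σ ∈ ramificationSubgroup K S, π σ = 1) :
    GaloisRep.IsUnramifiedOutside S (inflate π ρY) :=
  ((inflate π ρY).isUnramifiedOutside_iff_ramificationSubgroup_le_ker S).2 fun _ hσ =>
    mem_ker_inflate_of_map_eq_one π ρY (hπ _ hσ)

omit [TopologicalSpace Y] [DiscreteTopology Y] in
/-- A module killed by `(p : ℤ)` for SOME `ℤ`-module structure is `p`-primary (canonical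
structure; the hypothesis shape `∀ y, (p : ℤ) • y = 0` of the `(ψ, hψ)`-calculus).
[cite: MilneADT2006, I §5 (proof of Thm. 5.1, p. 69)] -/
theorem isPrimaryTorsion_of_forall_intModule_smul_eq_zero (inst : Module ℤ Y) {p : ℕ}
    (hp : ∀ y : Y, @HSMul.hSMul ℤ Y Y (@instHSMul ℤ Y inst.toSMul) (p : ℤ) y = 0) :
    IsPrimaryTorsion p Y := fun y => by
  refine ⟨1, ?_⟩
  have h := hp y
  have hinst : inst = AddCommGroup.toIntModule Y := Subsingleton.elim _ _
  subst hinst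
  rwa [pow_one, ← Nat.cast_smul_eq_nsmul ℤ]

end Inflate

/-! ### §2. Functoriality and exactness -/

section Hom

variable {K : Type u} [Field K]
variable {Q : Type*} [Group Q] [TopologicalSpace Q] [DiscreteTopology Q]
variable (π : absoluteGaloisGroup K →ₜ* Q)
variable {Y : Type u} [AddCommGroup Y] [TopologicalSpace Y] [DiscreteTopology Y]
variable {Y' : Type u} [AddCommGroup Y'] [TopologicalSpace Y'] [DiscreteTopology Y']
variable {Y'' : Type u} [AddCommGroup Y''] [TopologicalSpace Y''] [DiscreteTopology Y'']

/-- **Functoriality of inflation**: a `Q`-equivariant additive map `f : Y →+ Y'` is a morphism of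
the inflated topological representations. [cite: SerreGaloisCohomology1997, I §2.2] -/
def inflateHom {ρY : Representation ℤ Q Y} {ρY' : Representation ℤ Q Y'}
    (f : Y →+ Y') (hf : ∀ q y, f (ρY q y) = ρY' q (f y)) :
    (inflate π ρY).toTopRep ⟶ (inflate π ρY').toTopRep :=
  TopRep.ofHom ⟨⟨f.toIntLinearMap, continuous_of_discreteTopology⟩,
    fun σ => ContinuousLinearMap.ext fun y => hf (π σ) y⟩

/-- `inflateHom π f hf` is `f` on elements. [cite: SerreGaloisCohomology1997, I §2.2] -/
@[simp] theorem inflateHom_apply {ρY : Representation ℤ Q Y} {ρY' : Representation ℤ Q Y'}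
    (f : Y →+ Y') (hf : ∀ q y, f (ρY q y) = ρY' q (f y)) (y : Y) :
    (inflateHom π f hf).hom y = f y := rfl

/-- **Inflation is exact**: a short exact sequence `0 → Y →(f) Y' →(g) Y'' → 0` of `Q`-modules
(`f` injective, `g` surjective, `g ∘ f = 0`, `ker g ⊆ im f`) inflates to a short exact sequence of
discrete `Γ_K`-modules (`IsSES`). [cite: SerreGaloisCohomology1997, I §2.2] [cite: MilneADT2006, I §5 Lemma 5.3 (p. 69)] -/
theorem isSES_inflateHom {ρY : Representation ℤ Q Y} {ρY' : Representation ℤ Q Y'}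
    {ρY'' : Representation ℤ Q Y''} (f : Y →+ Y') (g : Y' →+ Y'')
    (hf : ∀ q y, f (ρY q y) = ρY' q (f y)) (hg : ∀ q y, g (ρY' q y) = ρY'' q (g y))
    (hinj : Function.Injective f) (hsurj : Function.Surjective g) (hgf : ∀ y, g (f y) = 0)
    (hex : ∀ y, g y = 0 → ∃ x, f x = y) :
    IsSES (inflateHom π f hf) (inflateHom π g hg) where
  comp_eq_zero := by
    ext y
    exact hgf y
  injective := hinj
  exact_mid := hex
  surjective := hsurj

end Hom

end DiscreteGaloisModule

/-! ### §3. The two standard quotients -/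

section Standard

variable {K : Type u} [Field K]

/-- For `Q = G_{K,S} ⧸ U` and `π = (Γ_K ↠ G_{K,S} ↠ G_{K,S}/U)`: `π` kills `N_S`.
[cite: Harari2020, Def. 15.36] -/
theorem toUnramifiedQuot_comp_eq_one_of_mem [NumberField K] (S : Set (HeightOneSpectrum (𝓞 K)))
    (U : Subgroup (GaloisGroupUnramifiedOutside K S)) [U.Normal]
    (σ : absoluteGaloisGroup K) (hσ : σ ∈ ramificationSubgroup K S) :
    ((ContinuousMonoidHom.quotientMk U).comp (toUnramifiedQuotCont K S)) σ = 1 := by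
  have h1 : toUnramifiedQuot K S σ = 1 := (QuotientGroup.eq_one_iff σ).2 hσ
  change ((toUnramifiedQuot K S σ : GaloisGroupUnramifiedOutside K S) :
    GaloisGroupUnramifiedOutside K S ⧸ U) = 1
  rw [h1, QuotientGroup.mk_one]

/-- For `Q = Gal(L/K)`, `L` a normal subextension of `K̄/K`: the continuous homomorphism
`σ ↦ σ|_L` (Mathlib `AlgEquiv.restrictNormalHom`, continuous for the Krull topologies by
`InfiniteGalois.restrictNormalHom_continuous`; the target is discrete when `L/K` is finite,
`krullTopology_discreteTopology_of_finiteDimensional`). [cite: SerreGaloisCohomology1997, I §2.2] -/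
def restrictNormalHomCont (L : IntermediateField K (AlgebraicClosure K)) [Normal K L] :
    absoluteGaloisGroup K →ₜ* (L ≃ₐ[K] L) :=
  ⟨AlgEquiv.restrictNormalHom (F := K) (K₁ := AlgebraicClosure K) L,
    InfiniteGalois.restrictNormalHom_continuous (k := K) (K := AlgebraicClosure K) L⟩

/-- Unfolding lemma for `restrictNormalHomCont`. [cite: SerreGaloisCohomology1997, I §2.2] -/
@[simp] theorem restrictNormalHomCont_apply (L : IntermediateField K (AlgebraicClosure K))
    [Normal K L] (σ : absoluteGaloisGroup K) :
    restrictNormalHomCont L σ = AlgEquiv.restrictNormalHom (F := K) (K₁ := AlgebraicClosure K) L σ :=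
  rfl

/-- `σ ↦ σ|_L` kills `Gal(K̄/L)` (the tree's `absGaloisFixingSubgroup L`), hence every subgroup
`N ≤ Gal(K̄/L)` — in particular `N_S` whenever `L ⊆ K_S`. [cite: SerreGaloisCohomology1997, I §2.2] -/
theorem restrictNormalHomCont_eq_one_of_mem (L : IntermediateField K (AlgebraicClosure K))
    [Normal K L] {N : Subgroup (absoluteGaloisGroup K)} (hN : N ≤ absGaloisFixingSubgroup L)
    (σ : absoluteGaloisGroup K) (hσ : σ ∈ N) : restrictNormalHomCont L σ = 1 := by
  have h := hN hσ
  rw [MonoidHom.mem_ker] at h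
  exact h

end Standard

end Literature.NumberTheory.GaloisRepresentations

end
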